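import Summits.BirchSwinnertonDyer.BirchSwinnertonDyer.Theorems.KimAtThreeKolyvaginPortSharedCert
import Summits.BirchSwinnertonDyer.BirchSwinnertonDyer.Theorems.KimAtThreeDeepUpperOfPortsClasswide
import HarnessLib

/-!
# The three W2 crux conclusions on a CLEAN Kato-stratum row WITHOUT the PORT binder: PORT″ replaced by
# the fine Kato witnesses + ONE unit minus modular symbol (cell `bsd-addord`, seat kim3 gen 10)

The row ENDs of the tree for the three W2 cruxes on the Kato stratum (additive `3`, `3 ∤ c₃`,
`E(ℚ₃)[3] = 0`, tower onto, lattice-optimal datum at conductor level, `3 ∤` Manin constant) display the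
shared-generator PORT″ `KatoKuriharaPortThreeAtWith₂ W 0 v₃ η D` (w2-c2's
`deepLower_optimal_of_ports_of_poitouTate` for 19075; w2-c3's `deepUpper_optimal_of_ports_of_poitouTate`
for 19076; `shallowEqDeep_conclusion_classwide_of_ports_of_stub` for 19077).  On a row WITHOUT anomalous
bad place (no non-zero `3`-torsion in `E(ℚ_w)` at the bad `w ≠ 3`; 26 245 of the 127 496 census rows,
kim3 census j255378) this seat's `KimAtThreeKolyvaginPortShared` / `…Cert` produce PORT″ from the FINE
KATO WITNESSES of the row (Kato's `ZetaBody` family for `D.f` in the `ω_W`-coordinate with the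
finite-level dual-exponential riders `KatoExpStarFiniteLevelAt` and a `3`-unit constant — the conclusion
of the PUBLISHED fact `Kato2004.exists_eulerSystem_expStar_values` plus n1011's construction-shaped
rider PK-5 / R-κ) and ONE certificate (a prime `q ≡ 2 (mod 3)`, `q ∤ N`, `3 ∤ q + 1 − a_q`, `n ≥ 1`,
`a₀` with `[a₀/q^n]⁻_{D.f}` a non-zero `3`-adic unit).  THIS FILE (theorems only; 0 defs / 0 facts /
0 sorry) re-keys the three ENDs accordingly:
* `portShared_row_of_witnesses_of_cert_of_noAnomalous` — PORT″ at the row from the row's own fine Kato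
  witnesses + certificate + no anomalous bad place (row-level form of the two class-level theorems);
* `deepLower_optimal_of_witnesses_of_cert_of_noAnomalous` — crux 19075's conclusion at `(W, D)` GRANTED
  [S24] (1)(2), GZK, Poitou–Tate, the fine Kato witnesses, the certificate, no anomalous bad place;
* `deepUpper_optimal_of_witnesses_of_cert_of_noAnomalous_of_stub` — crux 19076's conclusion, same + the
  STUB at the empty level (crux 19561) + `3`-integral plus symbols;
* `shallowEqDeep_optimal_of_witnesses_of_cert_of_noAnomalous_of_stub` — crux 19077's conclusion, same.
HONEST LIMITS: row theorems with displayed hypotheses (the fine witnesses are construction-shaped over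
the tree; the certificate is per-row data; the stub is crux 19561); nothing is booked; no crux closes.
References: kim3 memo KIM3-W2-PORT-g10.md; [Kato2004Asterisque] §8.1, Prop. 8.12, §9.4, Thm. 9.7,
Thm. 6.6 (1), Ex. 13.3; [Kim2022StructureSelmer] Thm. 3.13; [MazurRubin2004] Thm. 3.2.4, Thm. 4.4.1;
[Sakamoto2024] Thm. 4.4; [MilneADT2006] I.4.10.
-/

noncomputable section

set_option linter.dupNamespace false

open scoped NumberField TensorProduct Classical
open Function Field Finset IsDedekindDomain NumberField WeierstrassCurve Rat.HeightOneSpectrum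
open Literature.NumberTheory.GaloisRepresentations Literature.NumberTheory.GaloisCohomology
open Literature.NumberTheory.GaloisRepresentations.DiscreteGaloisModule
open Literature.NumberTheory.EllipticCurves Literature.NumberTheory.EllipticCurves.ModularForms
open Literature.NumberTheory.EllipticCurves.Rank1Residual
open Literature.NumberTheory.EllipticCurves.Kato2004
open Literature.NumberTheory.EllipticCurves.Kato2004.EulerSystemValues
open Summit.BirchSwinnertonDyer.Rank1Residual.GaloisImage
open Summit.BirchSwinnertonDyer.BirchSwinnertonDyer.Theorems.KimAtThreeDeepLowerKatoStratumOfFacts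
open Summit.BirchSwinnertonDyer.BirchSwinnertonDyer.Theorems.KimAtThreeDeepUpperOfPortsClasswide

namespace Summit.BirchSwinnertonDyer.BirchSwinnertonDyer.Theorems.KimAtThreeKolyvaginPortSharedEnds

/-! ### §1. PORT″ at a row from the row's own fine Kato witnesses and ONE certificate -/

/-- **PORT″ at a clean Kato-stratum row from the row's fine Kato witnesses and ONE unit minus symbol.**
Row-level form of `KimAtThreeKolyvaginPortShared.portShared_row_of_fineKato_of_certSupply_of_noAnomalous`
∘ `KimAtThreeKolyvaginPortSharedCert.certSupply_row_of_unitMinusSymbol`: the witnesses `(ι, κ, Λ, Λfin)`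
with `κ` a rational `3`-unit, the riders `KatoExpStarFiniteLevelAt` at every depth and the `ZetaBody`
family of `P.f` for all admissible auxiliary data, plus ONE certificate `(q, n, t, a₀)` and the absence
of anomalous bad places, give `KatoKuriharaPortThreeAtWith₂ W 0 v₃ η P` (★ PK-6₂ ∘ T-PK6-VDIS with
every other binder discharged). [cite: Kato2004Asterisque, (8.1.3) (p. 180), Prop. 8.12 (p. 186), Thm. 9.7 (p. 189), Thm. 6.6 (1) (p. 163), Ex. 13.3 (pp. 224–225)]
[cite: Kim2022StructureSelmer, Thm. 3.13 and §3.3–§3.4.1] -/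
theorem portShared_row_of_witnesses_of_cert_of_noAnomalous
    (W : WeierstrassCurve ℚ) [W.IsElliptic] [W.IsGloballyMinimal]
    [ContinuousSMul ℤ_[3] (W.tateModule 3)] [Module.Free ℤ_[3] (W.tateModule 3)]
    [Module.Finite ℤ_[3] (W.tateModule 3)]
    (htow : ∀ m : ℕ, W.HasSurjectiveModNGaloisRep (3 ^ m : ℕ))
    (hadd : haveI : Fact (Nat.Prime 3) := ⟨Nat.prime_three⟩; Addv W 3)
    (ht : Nat.card {Q : (W.baseChange ℚ_[3]).toAffine.Point // (3 : ℕ) • Q = 0} = 1)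
    (v₃ : HeightOneSpectrum (𝓞 ℚ))
    (η : (q : HeightOneSpectrum (𝓞 ℚ)) → (ZMod (Ideal.absNorm q.asIdeal))ˣ)
    {N : ℕ} [NeZero N] (P : ModularParametrizationData W N) (hN : N = W.conductorNorm ℤ)
    -- the fine Kato witnesses of the row (C1 at this row)
    {ι : (n : ℕ) → (CyclotomicField n ℚ →+* ℂ)} {κK : ℝ}
    {Λ : ∀ (k' : ℕ) (r : Finset (HeightOneSpectrum (𝓞 ℚ))),
      H1 (tateRep W 3) (cycSubgroup 3 k' r) →ₗ[ℤ_[3]] ℚ_[3] ⊗[ℚ] CyclotomicField (cycLevel 3 k' r) ℚ}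
    (Λfin : ∀ j : ℕ, galoisCohomology
      ((W.torsionGaloisModule (((3 : ℕ) : ℤ) ^ j * ((3 : ℕ) : ℤ))).toLocal (Sum.inr v₃)) 1 →+
        ZMod (3 ^ (j + 1)))
    (hκ0 : κK ≠ 0) (hNorm : ∃ u : ℚ, (u : ℝ) = κK ∧ padicValRat 3 u = 0)
    (hfin : ∀ j : ℕ, KatoExpStarFiniteLevelAt W 3 j 0 v₃ Λ (Λfin j))
    (hz : ∀ (c d a : ℤ) (A : ℕ), 0 < A → Int.gcd c (6 * 3 * A) = 1 → Int.gcd d (6 * 3 * N) = 1 →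
      ∃ (z : ∀ (k' : ℕ) (r : (cyclotomicLevelsRat 3 (badPlaces c d A N)).Ideals),
            H1 (tateRep W 3) ((cyclotomicLevelsRat 3 (badPlaces c d A N)).level k' r.1))
        (x : ∀ (k' : ℕ) (r : (cyclotomicLevelsRat 3 (badPlaces c d A N)).Ideals),
            CyclotomicField (cycLevel 3 k' r.1) ℚ),
        ZetaBody W 3 P.f ι κK Λ c d a A z x)
    -- ONE certificate (C2′ at this row)
    {q n : ℕ} (hq : q.Prime) (hq3 : q % 3 = 2) (hqN : ¬ q ∣ N) (hn : 1 ≤ n)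
    {t : ℤ} (hat : cuspCoeff P.f q = t) (h3t : ¬ (3 : ℤ) ∣ (q : ℤ) + 1 - t)
    {a₀ : ℤ} (hX0 : ratMinusSymbol P.f ((a₀ : ℚ) / ((q ^ n : ℕ) : ℚ)) ≠ 0)
    (hX : padicValRat 3 (ratMinusSymbol P.f ((a₀ : ℚ) / ((q ^ n : ℕ) : ℚ))) = 0)
    -- no anomalous bad place
    (hbad : ∀ w : HeightOneSpectrum (𝓞 ℚ), ¬ W.HasGoodReductionAt w →
      ((primesEquiv w : Nat.Primes) : ℕ) ≠ 3 →
        ∀ Q : (W.baseChange (w.adicCompletion ℚ)).toAffine.Point, 3 • Q = 0 → Q = 0) :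
    KatoKuriharaPortThreeAtWith₂ W 0 v₃ η P := by
  haveI : Fact (Nat.Prime 3) := ⟨Nat.prime_three⟩
  have h9 : 3 ^ 2 ∣ N := hN ▸ KimAtThreeKolyvaginPortShared.sq_dvd_conductorNorm_of_addv W hadd
  obtain ⟨c, d, a, A, d', aM, hA, hcA, hdN, hcdA, hcd, hdd', hAN, haM, hE0, hE, hR0, hR⟩ :=
    KimAtThreeKolyvaginPortSharedCert.certSupply_row_of_unitMinusSymbol W P h9 hq hq3 hqN hn hat h3t
      hX0 hX
  haveI : NeZero A := ⟨hA.ne'⟩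
  obtain ⟨z, x, hbody⟩ := hz c d a A hA hcA hdN
  exact katoKuriharaPortThreeAtWith₂_zero_of_zetaBody_of_valueRows W P hN hbody Λfin hfin hcdA hbad
    (fun w hw => KimAtThreeKolyvaginPortShared.forall_torsion_three_eq_zero_adicCompletion_of_natCard_eq_one
      W ht w hw)
    (KimAtThreeKolyvaginPortShared.hasIrreducibleModPGaloisRep_three_of_tower W htow) hNorm hκ0 d' hcd
    hdd' hAN h9 aM haM hE0 hE hR0 hR

/-! ### §2. The three crux conclusions at a clean optimal row, PORT″ replaced by witnesses + certificate -/

/-- **Crux 19075 (`DeepLowerAtThree`)'s conclusion at a clean optimal Kato-stratum row `(W, D)`,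
WITHOUT the PORT binder**: GRANTED [S24] (1)(2), GZK and Poitou–Tate (published, by name), the row's
fine Kato witnesses, ONE unit-minus-symbol certificate and the absence of anomalous bad places:
`∂^{(∞)}_deep = d ∈ ℕ` and `∂⁽⁰⁾ ≤ ord₃ #Ш(3) + d` — w2-c2's `deepLower_optimal_of_ports_of_poitouTate`
with `hPort := portShared_row_of_witnesses_of_cert_of_noAnomalous`. No stub, no plus-integrality needed.
[cite: Kim2025RefinedTNC, Thm 1.1] [cite: Sakamoto2024, Thm. 4.4 (p. 926)] [cite: MilneADT2006, Ch. I, Thm. 4.10] -/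
theorem deepLower_optimal_of_witnesses_of_cert_of_noAnomalous
    (hS24 : Sakamoto2024.kolyvaginSystems_freeRankOne_zmod_three_pow)
    (hS24₂ : Sakamoto2024.kolyvaginSystems_idealOfBasis_eq_fittingIdeal_zmod_three_pow)
    (hGZK : rank_eq_analyticRank_of_analyticRank_le_one)
    (hPT : poitouTate_selmerStructure_duality ℚ)
    (W : WeierstrassCurve ℚ) [W.IsElliptic] [W.IsGloballyMinimal]
    [ContinuousSMul ℤ_[3] (W.tateModule 3)] [Module.Free ℤ_[3] (W.tateModule 3)]
    [Module.Finite ℤ_[3] (W.tateModule 3)]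
    (hadd : haveI : Fact (Nat.Prime 3) := ⟨Nat.prime_three⟩; Addv W 3)
    (hc3 : ¬ 3 ∣ (W.baseChange ℚ_[3]).localTamagawaNumber ℤ_[3])
    (htower : ∀ m : ℕ, W.HasSurjectiveModNGaloisRep (3 ^ m : ℕ))
    (ht0 : Nat.card {Q : (W.baseChange ℚ_[3]).toAffine.Point // (3 : ℕ) • Q = 0} = 1)
    {N : ℕ} [NeZero N] (hN : N = W.conductorNorm ℤ) (D : ModularParametrizationData W N)
    (hopt : ∀ z ∈ D.L.lattice, ∃ w ∈ periodLattice D.f, z = D.c * w)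
    (hcD : ¬ (3 : ℤ) ∣ D.maninConstant)
    (v₃ : HeightOneSpectrum (𝓞 ℚ)) (hv₃ : ((3 : ℕ) : 𝓞 ℚ) ∈ v₃.asIdeal)
    (η : (q : HeightOneSpectrum (𝓞 ℚ)) → (ZMod (Ideal.absNorm q.asIdeal))ˣ)
    (hη : ∀ q : HeightOneSpectrum (𝓞 ℚ), Subgroup.zpowers (η q) = ⊤)
    {ι : (n : ℕ) → (CyclotomicField n ℚ →+* ℂ)} {κK : ℝ}
    {Λ : ∀ (k' : ℕ) (r : Finset (HeightOneSpectrum (𝓞 ℚ))),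
      H1 (tateRep W 3) (cycSubgroup 3 k' r) →ₗ[ℤ_[3]] ℚ_[3] ⊗[ℚ] CyclotomicField (cycLevel 3 k' r) ℚ}
    (Λfin : ∀ j : ℕ, galoisCohomology
      ((W.torsionGaloisModule (((3 : ℕ) : ℤ) ^ j * ((3 : ℕ) : ℤ))).toLocal (Sum.inr v₃)) 1 →+
        ZMod (3 ^ (j + 1)))
    (hκ0 : κK ≠ 0) (hNorm : ∃ u : ℚ, (u : ℝ) = κK ∧ padicValRat 3 u = 0)
    (hfin : ∀ j : ℕ, KatoExpStarFiniteLevelAt W 3 j 0 v₃ Λ (Λfin j))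
    (hz : ∀ (c d a : ℤ) (A : ℕ), 0 < A → Int.gcd c (6 * 3 * A) = 1 → Int.gcd d (6 * 3 * N) = 1 →
      ∃ (z : ∀ (k' : ℕ) (r : (cyclotomicLevelsRat 3 (badPlaces c d A N)).Ideals),
            H1 (tateRep W 3) ((cyclotomicLevelsRat 3 (badPlaces c d A N)).level k' r.1))
        (x : ∀ (k' : ℕ) (r : (cyclotomicLevelsRat 3 (badPlaces c d A N)).Ideals),
            CyclotomicField (cycLevel 3 k' r.1) ℚ),
        ZetaBody W 3 D.f ι κK Λ c d a A z x)
    {q n : ℕ} (hq : q.Prime) (hq3 : q % 3 = 2) (hqN : ¬ q ∣ N) (hn : 1 ≤ n)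
    {t : ℤ} (hat : cuspCoeff D.f q = t) (h3t : ¬ (3 : ℤ) ∣ (q : ℤ) + 1 - t)
    {a₀ : ℤ} (hX0 : ratMinusSymbol D.f ((a₀ : ℚ) / ((q ^ n : ℕ) : ℚ)) ≠ 0)
    (hX : padicValRat 3 (ratMinusSymbol D.f ((a₀ : ℚ) / ((q ^ n : ℕ) : ℚ))) = 0)
    (hbad : ∀ w : HeightOneSpectrum (𝓞 ℚ), ¬ W.HasGoodReductionAt w →
      ((primesEquiv w : Nat.Primes) : ℕ) ≠ 3 →
        ∀ Q : (W.baseChange (w.adicCompletion ℚ)).toAffine.Point, 3 • Q = 0 → Q = 0)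
    (hord : kuriharaVanishingOrder W 3 D.f = 0) :
    ∃ d : ℕ, kuriharaPartialDeepInfty W 3 D.f = d ∧
      kuriharaPartial W 3 D.f 0 ≤
        ((padicValNat 3 (Nat.card (AddCommGroup.primaryComponent W.sha 3)) + d : ℕ) : ℕ∞) :=
  deepLower_optimal_of_ports_of_poitouTate hS24 hS24₂ hGZK hPT W hadd hc3 htower ht0 hN D hopt hcD v₃ hv₃
    η hη
    (portShared_row_of_witnesses_of_cert_of_noAnomalous W htower hadd ht0 v₃ η D hN Λfin hκ0 hNorm hfin
      hz hq hq3 hqN hn hat h3t hX0 hX hbad)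
    hord

/-- **Crux 19076 (`DeepUpperAtThree`)'s conclusion at a clean optimal Kato-stratum row `(W, D)`,
WITHOUT the PORT binder**: GRANTED [S24] (1)(2), GZK, Poitou–Tate, the row's fine Kato witnesses, ONE
unit-minus-symbol certificate, no anomalous bad place, `3`-integral plus symbols and the STUB at the
empty level (crux 19561, binder `hStub` verbatim): `∂^{(∞)}_deep = d ∈ ℕ` and `ord₃ #Ш(3) + d ≤ ∂⁽⁰⁾`
— w2-c3's `deepUpper_optimal_of_ports_of_poitouTate` with
`hPort := portShared_row_of_witnesses_of_cert_of_noAnomalous`.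
[cite: Kim2025RefinedTNC, Thm 1.1] [cite: Sakamoto2024, Thm. 4.4 (p. 926)] [cite: MazurRubin2004, Thm. 4.4.1]
[cite: MilneADT2006, Ch. I, Thm. 4.10] -/
theorem deepUpper_optimal_of_witnesses_of_cert_of_noAnomalous_of_stub
    (hS24 : Sakamoto2024.kolyvaginSystems_freeRankOne_zmod_three_pow)
    (hS24₂ : Sakamoto2024.kolyvaginSystems_idealOfBasis_eq_fittingIdeal_zmod_three_pow)
    (hGZK : rank_eq_analyticRank_of_analyticRank_le_one)
    (hPT : poitouTate_selmerStructure_duality ℚ)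
    (W : WeierstrassCurve ℚ) [W.IsElliptic] [W.IsGloballyMinimal]
    [ContinuousSMul ℤ_[3] (W.tateModule 3)] [Module.Free ℤ_[3] (W.tateModule 3)]
    [Module.Finite ℤ_[3] (W.tateModule 3)]
    (hadd : haveI : Fact (Nat.Prime 3) := ⟨Nat.prime_three⟩; Addv W 3)
    (hc3 : ¬ 3 ∣ (W.baseChange ℚ_[3]).localTamagawaNumber ℤ_[3])
    (htower : ∀ m : ℕ, W.HasSurjectiveModNGaloisRep (3 ^ m : ℕ))
    (ht0 : Nat.card {Q : (W.baseChange ℚ_[3]).toAffine.Point // (3 : ℕ) • Q = 0} = 1)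
    {N : ℕ} [NeZero N] (hN : N = W.conductorNorm ℤ) (D : ModularParametrizationData W N)
    (hopt : ∀ z ∈ D.L.lattice, ∃ w ∈ periodLattice D.f, z = D.c * w)
    (hcD : ¬ (3 : ℤ) ∣ D.maninConstant)
    (hint : ∀ r : ℚ, ratPlusSymbol D.f r ≠ 0 → 0 ≤ padicValRat 3 (ratPlusSymbol D.f r))
    (hord : kuriharaVanishingOrder W 3 D.f = 0)
    (v₃ : HeightOneSpectrum (𝓞 ℚ)) (hv₃ : ((3 : ℕ) : 𝓞 ℚ) ∈ v₃.asIdeal)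
    (η : (q : HeightOneSpectrum (𝓞 ℚ)) → (ZMod (Ideal.absNorm q.asIdeal))ˣ)
    (hη : ∀ q : HeightOneSpectrum (𝓞 ℚ), Subgroup.zpowers (η q) = ⊤)
    {ι : (n : ℕ) → (CyclotomicField n ℚ →+* ℂ)} {κK : ℝ}
    {Λ : ∀ (k' : ℕ) (r : Finset (HeightOneSpectrum (𝓞 ℚ))),
      H1 (tateRep W 3) (cycSubgroup 3 k' r) →ₗ[ℤ_[3]] ℚ_[3] ⊗[ℚ] CyclotomicField (cycLevel 3 k' r) ℚ}
    (Λfin : ∀ j : ℕ, galoisCohomology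
      ((W.torsionGaloisModule (((3 : ℕ) : ℤ) ^ j * ((3 : ℕ) : ℤ))).toLocal (Sum.inr v₃)) 1 →+
        ZMod (3 ^ (j + 1)))
    (hκ0 : κK ≠ 0) (hNorm : ∃ u : ℚ, (u : ℝ) = κK ∧ padicValRat 3 u = 0)
    (hfin : ∀ j : ℕ, KatoExpStarFiniteLevelAt W 3 j 0 v₃ Λ (Λfin j))
    (hz : ∀ (c d a : ℤ) (A : ℕ), 0 < A → Int.gcd c (6 * 3 * A) = 1 → Int.gcd d (6 * 3 * N) = 1 →
      ∃ (z : ∀ (k' : ℕ) (r : (cyclotomicLevelsRat 3 (badPlaces c d A N)).Ideals),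
            H1 (tateRep W 3) ((cyclotomicLevelsRat 3 (badPlaces c d A N)).level k' r.1))
        (x : ∀ (k' : ℕ) (r : (cyclotomicLevelsRat 3 (badPlaces c d A N)).Ideals),
            CyclotomicField (cycLevel 3 k' r.1) ℚ),
        ZetaBody W 3 D.f ι κK Λ c d a A z x)
    {q n : ℕ} (hq : q.Prime) (hq3 : q % 3 = 2) (hqN : ¬ q ∣ N) (hn : 1 ≤ n)
    {t : ℤ} (hat : cuspCoeff D.f q = t) (h3t : ¬ (3 : ℤ) ∣ (q : ℤ) + 1 - t)
    {a₀ : ℤ} (hX0 : ratMinusSymbol D.f ((a₀ : ℚ) / ((q ^ n : ℕ) : ℚ)) ≠ 0)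
    (hX : padicValRat 3 (ratMinusSymbol D.f ((a₀ : ℚ) / ((q ^ n : ℕ) : ℚ))) = 0)
    (hbad : ∀ w : HeightOneSpectrum (𝓞 ℚ), ¬ W.HasGoodReductionAt w →
      ((primesEquiv w : Nat.Primes) : ℕ) ≠ 3 →
        ∀ Q : (W.baseChange (w.adicCompletion ℚ)).toAffine.Point, 3 • Q = 0 → Q = 0)
    (hStub : ∀ (k : ℕ)
      (Dk : KolyvaginDatum (W.torsionGaloisModule (((3 : ℕ) : ℤ) ^ k * ((3 : ℕ) : ℤ))))
      (g : Finset (HeightOneSpectrum (𝓞 ℚ)) →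
        galoisCohomology (W.torsionGaloisModule (((3 : ℕ) : ℤ) ^ k * ((3 : ℕ) : ℤ))) 1)
      (n₀ : ℕ), Dk.IsCanonicalTauDatumThreeAtWith W k k η →
        g ∈ Dk.kolyvaginSystems (propagatedSelmerStructure W 3 k) →
        (∀ κ ∈ Dk.kolyvaginSystems (propagatedSelmerStructure W 3 k), ∃ a : ℕ, κ = a • g) →
        Nat.card (propagatedSelmerStructure W 3 k).selmerGroup = 3 ^ (k + 1) * 3 ^ n₀ →
        ∃ e ∈ (propagatedSelmerStructure W 3 k).selmerGroup,
          ∃ m ∈ (W.kummerSelmerStructure (((3 : ℕ) : ℤ) ^ k * ((3 : ℕ) : ℤ))).selmerGroup,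
            g ∅ = 3 ^ n₀ • e + m) :
    ∃ dd : ℕ, kuriharaPartialDeepInfty W 3 D.f = dd ∧
      ((padicValNat 3 (Nat.card (AddCommGroup.primaryComponent W.sha 3)) + dd : ℕ) : ℕ∞) ≤
        kuriharaPartial W 3 D.f 0 :=
  deepUpper_optimal_of_ports_of_poitouTate hS24 hS24₂ hGZK hPT W hadd hc3 htower ht0 D hopt hcD hint hord
    v₃ hv₃ η hη
    (portShared_row_of_witnesses_of_cert_of_noAnomalous W htower hadd ht0 v₃ η D hN Λfin hκ0 hNorm hfin
      hz hq hq3 hqN hn hat h3t hX0 hX hbad)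
    hStub

/-- **Crux 19077 (`ShallowEqDeepAtTorsionFree`)'s conclusion at a clean optimal Kato-stratum row,
WITHOUT the PORT binder**: same inputs as the 19076 END (the row read at `W = W₀`):
`∂^{(∞)}_deep(δ̃) ≤ ∂^{(∞)}(δ̃)` — w2-c3's `shallowEqDeep_conclusion_classwide_of_ports_of_stub` at the
identity isogeny with `hPort := portShared_row_of_witnesses_of_cert_of_noAnomalous`.
[cite: Kim2025RefinedTNC, Thm 1.1] [cite: Sakamoto2024, Thm. 4.4 (p. 926)] [cite: MazurRubin2004, Thm. 4.4.1]
[cite: MilneADT2006, Ch. I, Thm. 4.10] -/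
theorem shallowEqDeep_optimal_of_witnesses_of_cert_of_noAnomalous_of_stub
    (hS24 : Sakamoto2024.kolyvaginSystems_freeRankOne_zmod_three_pow)
    (hS24₂ : Sakamoto2024.kolyvaginSystems_idealOfBasis_eq_fittingIdeal_zmod_three_pow)
    (hGZK : rank_eq_analyticRank_of_analyticRank_le_one)
    (hPT : poitouTate_selmerStructure_duality ℚ)
    (W : WeierstrassCurve ℚ) [W.IsElliptic] [W.IsGloballyMinimal]
    [ContinuousSMul ℤ_[3] (W.tateModule 3)] [Module.Free ℤ_[3] (W.tateModule 3)]
    [Module.Finite ℤ_[3] (W.tateModule 3)]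
    (hadd : haveI : Fact (Nat.Prime 3) := ⟨Nat.prime_three⟩; Addv W 3)
    (hc3 : ¬ 3 ∣ (W.baseChange ℚ_[3]).localTamagawaNumber ℤ_[3])
    (htower : ∀ m : ℕ, W.HasSurjectiveModNGaloisRep (3 ^ m : ℕ))
    (ht0 : Nat.card {Q : (W.baseChange ℚ_[3]).toAffine.Point // (3 : ℕ) • Q = 0} = 1)
    {N : ℕ} [NeZero N] (hN : N = W.conductorNorm ℤ) (D : ModularParametrizationData W N)
    (hopt : ∀ z ∈ D.L.lattice, ∃ w ∈ periodLattice D.f, z = D.c * w)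
    (hcD : ¬ (3 : ℤ) ∣ D.maninConstant)
    (hint : ∀ r : ℚ, ratPlusSymbol D.f r ≠ 0 → 0 ≤ padicValRat 3 (ratPlusSymbol D.f r))
    (hord : kuriharaVanishingOrder W 3 D.f = 0)
    (v₃ : HeightOneSpectrum (𝓞 ℚ)) (hv₃ : ((3 : ℕ) : 𝓞 ℚ) ∈ v₃.asIdeal)
    (η : (q : HeightOneSpectrum (𝓞 ℚ)) → (ZMod (Ideal.absNorm q.asIdeal))ˣ)
    (hη : ∀ q : HeightOneSpectrum (𝓞 ℚ), Subgroup.zpowers (η q) = ⊤)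
    {ι : (n : ℕ) → (CyclotomicField n ℚ →+* ℂ)} {κK : ℝ}
    {Λ : ∀ (k' : ℕ) (r : Finset (HeightOneSpectrum (𝓞 ℚ))),
      H1 (tateRep W 3) (cycSubgroup 3 k' r) →ₗ[ℤ_[3]] ℚ_[3] ⊗[ℚ] CyclotomicField (cycLevel 3 k' r) ℚ}
    (Λfin : ∀ j : ℕ, galoisCohomology
      ((W.torsionGaloisModule (((3 : ℕ) : ℤ) ^ j * ((3 : ℕ) : ℤ))).toLocal (Sum.inr v₃)) 1 →+
        ZMod (3 ^ (j + 1)))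
    (hκ0 : κK ≠ 0) (hNorm : ∃ u : ℚ, (u : ℝ) = κK ∧ padicValRat 3 u = 0)
    (hfin : ∀ j : ℕ, KatoExpStarFiniteLevelAt W 3 j 0 v₃ Λ (Λfin j))
    (hz : ∀ (c d a : ℤ) (A : ℕ), 0 < A → Int.gcd c (6 * 3 * A) = 1 → Int.gcd d (6 * 3 * N) = 1 →
      ∃ (z : ∀ (k' : ℕ) (r : (cyclotomicLevelsRat 3 (badPlaces c d A N)).Ideals),
            H1 (tateRep W 3) ((cyclotomicLevelsRat 3 (badPlaces c d A N)).level k' r.1))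
        (x : ∀ (k' : ℕ) (r : (cyclotomicLevelsRat 3 (badPlaces c d A N)).Ideals),
            CyclotomicField (cycLevel 3 k' r.1) ℚ),
        ZetaBody W 3 D.f ι κK Λ c d a A z x)
    {q n : ℕ} (hq : q.Prime) (hq3 : q % 3 = 2) (hqN : ¬ q ∣ N) (hn : 1 ≤ n)
    {t : ℤ} (hat : cuspCoeff D.f q = t) (h3t : ¬ (3 : ℤ) ∣ (q : ℤ) + 1 - t)
    {a₀ : ℤ} (hX0 : ratMinusSymbol D.f ((a₀ : ℚ) / ((q ^ n : ℕ) : ℚ)) ≠ 0)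
    (hX : padicValRat 3 (ratMinusSymbol D.f ((a₀ : ℚ) / ((q ^ n : ℕ) : ℚ))) = 0)
    (hbad : ∀ w : HeightOneSpectrum (𝓞 ℚ), ¬ W.HasGoodReductionAt w →
      ((primesEquiv w : Nat.Primes) : ℕ) ≠ 3 →
        ∀ Q : (W.baseChange (w.adicCompletion ℚ)).toAffine.Point, 3 • Q = 0 → Q = 0)
    (hStub : ∀ (k : ℕ)
      (Dk : KolyvaginDatum (W.torsionGaloisModule (((3 : ℕ) : ℤ) ^ k * ((3 : ℕ) : ℤ))))
      (g : Finset (HeightOneSpectrum (𝓞 ℚ)) →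
        galoisCohomology (W.torsionGaloisModule (((3 : ℕ) : ℤ) ^ k * ((3 : ℕ) : ℤ))) 1)
      (n₀ : ℕ), Dk.IsCanonicalTauDatumThreeAtWith W k k η →
        g ∈ Dk.kolyvaginSystems (propagatedSelmerStructure W 3 k) →
        (∀ κ ∈ Dk.kolyvaginSystems (propagatedSelmerStructure W 3 k), ∃ a : ℕ, κ = a • g) →
        Nat.card (propagatedSelmerStructure W 3 k).selmerGroup = 3 ^ (k + 1) * 3 ^ n₀ →
        ∃ e ∈ (propagatedSelmerStructure W 3 k).selmerGroup,
          ∃ m ∈ (W.kummerSelmerStructure (((3 : ℕ) : ℤ) ^ k * ((3 : ℕ) : ℤ))).selmerGroup,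
            g ∅ = 3 ^ n₀ • e + m) :
    kuriharaPartialDeepInfty W 3 D.f ≤ kuriharaPartialInfty W 3 D.f :=
  shallowEqDeep_conclusion_classwide_of_ports_of_stub hS24 hS24₂ hGZK hPT W W (IsIsogenous.refl_holds W)
    hadd htower ht0 hc3 hN D hopt hcD hint v₃ hv₃ η hη
    (portShared_row_of_witnesses_of_cert_of_noAnomalous W htower hadd ht0 v₃ η D hN Λfin hκ0 hNorm hfin
      hz hq hq3 hqN hn hat h3t hX0 hX hbad)
    hStub hord

end Summit.BirchSwinnertonDyer.BirchSwinnertonDyer.Theorems.KimAtThreeKolyvaginPortSharedEnds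

end
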